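import Summits.ValiantsHypothesis.ValiantsHypothesis.Theorems.LacunarySymmetroidMatrixDescartesPivotTwoDirectionsAnySize

/-!
# `MatrixDescartes` census — two-direction pencils at every size: the GRAM TRICHOTOMY and the pivot-currency lone-letter law
# (Gram matrix `WᵀJ⁻¹W` of the two directions SEMIDEFINITE ⇒ the `2K` law `Z₊ ≤ 2·#(supp f ∪ supp g)`, positive semidefinite ⇒ NO positive
#  root; INDEFINITE = the hard cell; a lone full-rank letter against parallel null letters: `Z₊ ≤ 2K − 1` at every size)

HONEST FRAMING.  Object-search cell `pub-symmetroid`, seat `val-sym-mdr-p2` (generation 25); helper file `--supports` the crux item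
stmt-ValiantsHypothesis-18050 (`Theses.LacunarySymmetroid.MatrixDescartes`, OPEN, on HOLD) with NO closure claim.  Sequel of
`…PivotTwoDirectionsAnySize` (`det (X^e J + f·uuᵀ + g·vvᵀ) = X^{(m−2)e}·Φ`, `Φ = X^{2e}dJ + X^e(f·mu + g·mv) + fg·D2`, `dJ = det J`,
`mu = det J·a`, `mv = det J·c`, `D2 = det J·(ac − bb')` with `a = uᵀJ⁻¹u`, `c = vᵀJ⁻¹v`, `b = uᵀJ⁻¹v`, `b' = vᵀJ⁻¹u`).  For ANY non-singular
`J` (no symmetry) and `f, g` of non-negative coefficients, the signs of the four coefficient families of `Φ` are `sign(det J)·(1, a, c, ac − bb')`: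
* **`posRoots_twoDir_anySize_eq_zero_of_gram_pos`**: `a ≥ 0`, `c ≥ 0`, `ac − bb' ≥ 0` (for symmetric `J`: the Gram matrix `WᵀJ⁻¹W` of the two
  directions positive semidefinite) ⇒ NO positive root at all (every coefficient of `Φ` has the sign of `det J`);
* **`posRoots_twoDir_anySize_le_of_gram_det_nonneg`**: `ac − bb' ≥ 0` ALONE (`a, c` of any sign; for symmetric `J`: Gram matrix
  semidefinite of either sign) ⇒ the coefficients of sign `−sign(det J)` sit at `e + (supp f ∪ supp g)` only ⇒ **`Z₊ ≤ 2·#(supp f ∪ supp g)`**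
  — the conjectured `2K` law of the `(2,K)` rows HOLDS for two-direction pencils at every size OFF the indefinite-Gram locus;
* the remaining case `ac − bb' < 0` (indefinite Gram matrix; at `m = 2` with an indefinite pivot it is the only case, `det(WᵀJ⁻¹W) = Δ²/det J`)
  is the size-`m` weak hard cell of `…AnySize`, where the `(2,K)` two-direction laws hold verbatim and `2K` is OPEN.
* **`pivotPosRoots_anySize_le_of_lone_fullRank`** (pivot currency, every size `m + 2`): letter `k₀` = `a₀·uuᵀ + b₀·vvᵀ` (`a₀, b₀ > 0`) off the
  pivot exponent, every other letter `cₖ·vvᵀ` (`cₖ ≥ 0`), `det J < 0`, `mu ≤ 0`, `mv ≤ 0`, `D2 > 0`: `pivotPosRoots e d J P + 1 ≤ 2K` — the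
  m = 2 law `PosEnds.pivotPosRoots_le_of_lone_fullRank` at every size.
Nothing here bears on `Theses.LacunarySymmetroid.MatrixDescartes` in its window, on `KPlusLogSqLaw`, on `DoorA26` / `DoorA34`, on the cell's
registers or credences, or on `VP ≠ VNP`.

[folklore] Descartes with a support budget (tree `Pivot.TwoDescartes.card_posRoots_le_two_mul_card`), `TwoDirections.Ends.coeff_twoDirDet`,
`…AnySize.posRoots_twoDir_anySize_eq`.  No definitions, no named facts.
-/

-- `Summit.ValiantsHypothesis.ValiantsHypothesis.…` repeats a component by the D-0017 layout
-- (single-conjunct summit), which the `dupNamespace` linter flags; the name is mandated.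
set_option linter.dupNamespace false

namespace Summit.ValiantsHypothesis.ValiantsHypothesis.Theorems.LacunarySymmetroidMatrixDescartes.Pivot.TwoDirections.AnySize

open Polynomial Matrix Finset
open scoped BigOperators

/-! ## 1. Sign bookkeeping for `Φ` with coefficients `(dJ, dJ·a, dJ·c, dJ·q)` -/

/-- If `a, c, q ≥ 0` and `f, g` have non-negative coefficients, every coefficient of `Φ = X^{2e}dJ + X^e f (dJ a) + X^e g (dJ c) + f g (dJ q)` is
`dJ` times a non-negative number. [folklore] -/
theorem coeff_Φ_eq_dJ_mul (e : ℕ) (f g : ℝ[X]) (dJ a c q : ℝ) (n : ℕ) :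
    ((X : ℝ[X]) ^ (2 * e) * Polynomial.C dJ + (X : ℝ[X]) ^ e * f * Polynomial.C (dJ * a) + (X : ℝ[X]) ^ e * g * Polynomial.C (dJ * c)
        + f * g * Polynomial.C (dJ * q)).coeff n
      = dJ * ((if n = 2 * e then 1 else 0) + a * (if e ≤ n then f.coeff (n - e) else 0)
          + c * (if e ≤ n then g.coeff (n - e) else 0) + q * (f * g).coeff n) := by
  rw [Ends.coeff_twoDirDet]
  by_cases h : n = 2 * e
  · rw [if_pos h, if_pos h]; ring
  · rw [if_neg h, if_neg h]; ring

/-- **GRAM-POSITIVE ⇒ NO POSITIVE ROOT** (scalar form): `a, c, q ≥ 0`, `f, g` of non-negative coefficients, `dJ ≠ 0` ⇒ `Φ` has no positive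
root. [folklore] -/
theorem posRoots_Φ_eq_zero_of_nonneg (e : ℕ) (f g : ℝ[X]) (dJ a c q : ℝ) (hdJ : dJ ≠ 0) (ha : 0 ≤ a) (hc : 0 ≤ c) (hq : 0 ≤ q)
    (hf0 : ∀ i, 0 ≤ f.coeff i) (hg0 : ∀ j, 0 ≤ g.coeff j) :
    ((((X : ℝ[X]) ^ (2 * e) * Polynomial.C dJ + (X : ℝ[X]) ^ e * f * Polynomial.C (dJ * a) + (X : ℝ[X]) ^ e * g * Polynomial.C (dJ * c)
        + f * g * Polynomial.C (dJ * q)).roots.toFinset.filter (fun t => 0 < t)).card) = 0 := by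
  classical
  set Φ := (X : ℝ[X]) ^ (2 * e) * Polynomial.C dJ + (X : ℝ[X]) ^ e * f * Polynomial.C (dJ * a)
    + (X : ℝ[X]) ^ e * g * Polynomial.C (dJ * c) + f * g * Polynomial.C (dJ * q) with hΦ
  have hnn : ∀ n, 0 ≤ (if n = 2 * e then (1 : ℝ) else 0) + a * (if e ≤ n then f.coeff (n - e) else 0)
      + c * (if e ≤ n then g.coeff (n - e) else 0) + q * (f * g).coeff n := by
    intro n
    have h1 : 0 ≤ (if n = 2 * e then (1 : ℝ) else 0) := by split_ifs <;> norm_num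
    have h2 : 0 ≤ a * (if e ≤ n then f.coeff (n - e) else 0) := by
      split_ifs; exacts [mul_nonneg ha (hf0 _), by simp]
    have h3 : 0 ≤ c * (if e ≤ n then g.coeff (n - e) else 0) := by
      split_ifs; exacts [mul_nonneg hc (hg0 _), by simp]
    have h4 : 0 ≤ q * (f * g).coeff n := mul_nonneg hq (Ends.coeff_mul_nonneg_of_nonneg f g hf0 hg0 n)
    linarith
  rcases lt_or_gt_of_ne hdJ with hneg | hpos
  · -- every coefficient `≤ 0`: apply the count to `−Φ` with an EMPTY budget... via `Φ` itself: no POSITIVE coefficient of `−(−Φ)`…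
    have h := Pivot.TwoDescartes.card_posRoots_le_two_mul_card (-Φ) ∅ (fun n hn => by
      rw [Polynomial.coeff_neg, hΦ, coeff_Φ_eq_dJ_mul] at hn
      have := mul_nonpos_of_nonpos_of_nonneg hneg.le (hnn n)
      linarith)
    rw [Polynomial.roots_neg, Finset.card_empty, mul_zero] at h
    exact Nat.le_zero.mp h
  · have h := Pivot.TwoDescartes.card_posRoots_le_two_mul_card Φ ∅ (fun n hn => by
      rw [hΦ, coeff_Φ_eq_dJ_mul] at hn
      have := mul_nonneg hpos.le (hnn n)
      linarith)
    rw [Finset.card_empty, mul_zero] at h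
    exact Nat.le_zero.mp h

/-- **`q ≥ 0` ⇒ `Z₊ ≤ 2·#(supp f ∪ supp g)`** (scalar form; `a, c` of ANY sign): with `f, g` of non-negative coefficients and `dJ ≠ 0`, the
coefficients of `Φ` whose sign is opposite to `dJ` sit at the degrees `e + (supp f ∪ supp g)` only. [folklore] -/
theorem posRoots_Φ_le_of_det_nonneg (e : ℕ) (f g : ℝ[X]) (dJ a c q : ℝ) (hdJ : dJ ≠ 0) (hq : 0 ≤ q)
    (hf0 : ∀ i, 0 ≤ f.coeff i) (hg0 : ∀ j, 0 ≤ g.coeff j) :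
    ((((X : ℝ[X]) ^ (2 * e) * Polynomial.C dJ + (X : ℝ[X]) ^ e * f * Polynomial.C (dJ * a) + (X : ℝ[X]) ^ e * g * Polynomial.C (dJ * c)
        + f * g * Polynomial.C (dJ * q)).roots.toFinset.filter (fun t => 0 < t)).card) ≤ 2 * (f.support ∪ g.support).card := by
  classical
  set Φ := (X : ℝ[X]) ^ (2 * e) * Polynomial.C dJ + (X : ℝ[X]) ^ e * f * Polynomial.C (dJ * a)
    + (X : ℝ[X]) ^ e * g * Polynomial.C (dJ * c) + f * g * Polynomial.C (dJ * q) with hΦ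
  set S : Finset ℕ := (f.support ∪ g.support).image (fun i => i + e) with hS
  have hScard : S.card ≤ (f.support ∪ g.support).card := Finset.card_image_le
  -- off `S`, the bracket is `≥ 0`, so the coefficient has the sign of `dJ`
  have key : ∀ n, n ∉ S → 0 ≤ (if n = 2 * e then (1 : ℝ) else 0) + a * (if e ≤ n then f.coeff (n - e) else 0)
      + c * (if e ≤ n then g.coeff (n - e) else 0) + q * (f * g).coeff n := by
    intro n hn
    rw [hS, Finset.mem_image] at hn
    push Not at hn
    have hf' : (if e ≤ n then f.coeff (n - e) else 0) = 0 := by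
      split_ifs with hle
      · by_contra hne
        exact hn (n - e) (Finset.mem_union.mpr (Or.inl (Polynomial.mem_support_iff.mpr hne))) (by omega)
      · rfl
    have hg' : (if e ≤ n then g.coeff (n - e) else 0) = 0 := by
      split_ifs with hle
      · by_contra hne
        exact hn (n - e) (Finset.mem_union.mpr (Or.inr (Polynomial.mem_support_iff.mpr hne))) (by omega)
      · rfl
    rw [hf', hg', mul_zero, mul_zero, add_zero, add_zero]
    have h1 : 0 ≤ (if n = 2 * e then (1 : ℝ) else 0) := by split_ifs <;> norm_num
    have h4 : 0 ≤ q * (f * g).coeff n := mul_nonneg hq (Ends.coeff_mul_nonneg_of_nonneg f g hf0 hg0 n)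
    linarith
  rcases lt_or_gt_of_ne hdJ with hneg | hpos
  · -- `dJ < 0`: off `S` coefficients are `≤ 0`; a POSITIVE coefficient of `Φ` = negative of `−Φ` lies in `S`
    have h := Pivot.TwoDescartes.card_posRoots_le_two_mul_card (-Φ) S (fun n hn => by
      by_contra hnS
      rw [Polynomial.coeff_neg, hΦ, coeff_Φ_eq_dJ_mul] at hn
      have := mul_nonpos_of_nonpos_of_nonneg hneg.le (key n hnS)
      linarith)
    rw [Polynomial.roots_neg] at h
    omega
  · have h := Pivot.TwoDescartes.card_posRoots_le_two_mul_card Φ S (fun n hn => by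
      by_contra hnS
      rw [hΦ, coeff_Φ_eq_dJ_mul] at hn
      have := mul_nonneg hpos.le (key n hnS)
      linarith)
    omega

/-! ## 2. Matrix forms at every size `m + 2` -/

variable {m : ℕ}

/-- **GRAM-POSITIVE TWO-DIRECTION PENCILS HAVE NO POSITIVE ROOT, AT EVERY SIZE**: `det J ≠ 0`, `uᵀJ⁻¹u ≥ 0`, `vᵀJ⁻¹v ≥ 0`,
`(uᵀJ⁻¹u)(vᵀJ⁻¹v) − (uᵀJ⁻¹v)(vᵀJ⁻¹u) ≥ 0` (for symmetric `J`: the Gram matrix `WᵀJ⁻¹W` of the two directions is positive semidefinite),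
`f, g` of non-negative coefficients ⇒ `Z₊ = 0`. [this file] -/
theorem posRoots_twoDir_anySize_eq_zero_of_gram_pos (e : ℕ) (J : Matrix (Fin (m + 2)) (Fin (m + 2)) ℝ) (hJ : J.det ≠ 0)
    (u v : Fin (m + 2) → ℝ) (f g : ℝ[X]) (hf0 : ∀ i, 0 ≤ f.coeff i) (hg0 : ∀ j, 0 ≤ g.coeff j)
    (ha : 0 ≤ u ⬝ᵥ J⁻¹ *ᵥ u) (hc : 0 ≤ v ⬝ᵥ J⁻¹ *ᵥ v)
    (hq : 0 ≤ (u ⬝ᵥ J⁻¹ *ᵥ u) * (v ⬝ᵥ J⁻¹ *ᵥ v) - (u ⬝ᵥ J⁻¹ *ᵥ v) * (v ⬝ᵥ J⁻¹ *ᵥ u)) :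
    ((Matrix.det (((X : ℝ[X]) ^ e) • J.map Polynomial.C + f • (vecMulVec u u).map Polynomial.C
        + g • (vecMulVec v v).map Polynomial.C)).roots.toFinset.filter (fun t => 0 < t)).card = 0 := by
  rw [posRoots_twoDir_anySize_eq e J hJ u v f g]
  exact posRoots_Φ_eq_zero_of_nonneg e f g _ _ _ _ hJ ha hc hq hf0 hg0

/-- **THE `2K` LAW OFF THE INDEFINITE GRAM LOCUS, AT EVERY SIZE**: `det J ≠ 0` and `(uᵀJ⁻¹u)(vᵀJ⁻¹v) − (uᵀJ⁻¹v)(vᵀJ⁻¹u) ≥ 0` (for symmetric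
`J`: the Gram matrix `WᵀJ⁻¹W` of the two directions is semidefinite — of either sign) ⇒ `Z₊ ≤ 2·#(supp f ∪ supp g)` (twice the number of
distinct letter exponents).  The open hard cell of the two-direction family at size `m` is exactly the INDEFINITE Gram matrix (at `m = 2` with an
indefinite pivot it always is: `det(WᵀJ⁻¹W) = Δ²/det J < 0`). [this file] -/
theorem posRoots_twoDir_anySize_le_of_gram_det_nonneg (e : ℕ) (J : Matrix (Fin (m + 2)) (Fin (m + 2)) ℝ) (hJ : J.det ≠ 0)
    (u v : Fin (m + 2) → ℝ) (f g : ℝ[X]) (hf0 : ∀ i, 0 ≤ f.coeff i) (hg0 : ∀ j, 0 ≤ g.coeff j)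
    (hq : 0 ≤ (u ⬝ᵥ J⁻¹ *ᵥ u) * (v ⬝ᵥ J⁻¹ *ᵥ v) - (u ⬝ᵥ J⁻¹ *ᵥ v) * (v ⬝ᵥ J⁻¹ *ᵥ u)) :
    ((Matrix.det (((X : ℝ[X]) ^ e) • J.map Polynomial.C + f • (vecMulVec u u).map Polynomial.C
        + g • (vecMulVec v v).map Polynomial.C)).roots.toFinset.filter (fun t => 0 < t)).card ≤ 2 * (f.support ∪ g.support).card := by
  rw [posRoots_twoDir_anySize_eq e J hJ u v f g]
  exact posRoots_Φ_le_of_det_nonneg e f g _ _ _ _ hJ hq hf0 hg0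

/-! ## 3. Pivot currency: a lone full-rank letter against parallel null letters, every size -/

variable {K : ℕ}

/-- The letter sum of the family «letter `k₀` is `a·uuᵀ + b·vvᵀ`, every other letter is `cₖ·vvᵀ`» collapses to the two-direction form
(size-generic copy of `PosEnds.letters_eq_lone_fullRank`). [bookkeeping] -/
theorem letters_eq_lone_fullRank_anySize (d : Fin K → ℕ) (u v : Fin (m + 2) → ℝ) (k₀ : Fin K) (a b : ℝ) (c : Fin K → ℝ)
    (P : Fin K → Matrix (Fin (m + 2)) (Fin (m + 2)) ℝ) (hP0 : P k₀ = a • vecMulVec u u + b • vecMulVec v v)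
    (hP : ∀ k, k ≠ k₀ → P k = c k • vecMulVec v v) :
    ∑ k, ((X : ℝ[X]) ^ d k) • (P k).map Polynomial.C
      = (Polynomial.C a * X ^ d k₀) • (vecMulVec u u).map Polynomial.C
        + (Polynomial.C b * X ^ d k₀ + ∑ k ∈ univ.erase k₀, Polynomial.C (c k) * X ^ d k)
            • (vecMulVec v v).map Polynomial.C := by
  classical
  rw [← Finset.add_sum_erase univ _ (Finset.mem_univ k₀), hP0, add_smul, Finset.sum_smul]
  have hterm : ∀ k ∈ univ.erase k₀, ((X : ℝ[X]) ^ d k) • (P k).map Polynomial.C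
      = (Polynomial.C (c k) * X ^ d k) • (vecMulVec v v).map Polynomial.C := by
    intro k hk
    rw [hP k (Finset.ne_of_mem_erase hk)]
    ext i j
    simp only [Matrix.smul_apply, Matrix.map_apply, smul_eq_mul, map_mul]
    ring
  rw [Finset.sum_congr rfl hterm, ← add_assoc]
  congr 1
  ext i j
  simp only [Matrix.add_apply, Matrix.smul_apply, Matrix.map_apply, smul_eq_mul, map_mul, map_add]
  ring

/-- **A LONE FULL-RANK LETTER AGAINST PARALLEL NULL LETTERS, EVERY SIZE: `pivotPosRoots + 1 ≤ 2K`** (size `m + 2`; `det J < 0`,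
`det J·(uᵀJ⁻¹u) ≤ 0`, `det J·(vᵀJ⁻¹v) ≤ 0`, `det J·((uᵀJ⁻¹u)(vᵀJ⁻¹v) − (uᵀJ⁻¹v)(vᵀJ⁻¹u)) > 0` — the size-`m` weak hard cell; `a, b > 0`,
`cₖ ≥ 0`, `d k₀ ≠ e`; no symmetry or index hypothesis is used). [this file] -/
theorem pivotPosRoots_anySize_le_of_lone_fullRank (e : ℕ) (d : Fin K → ℕ) (J : Matrix (Fin (m + 2)) (Fin (m + 2)) ℝ)
    (u v : Fin (m + 2) → ℝ) (k₀ : Fin K) (a b : ℝ) (c : Fin K → ℝ) (ha : 0 < a) (hb : 0 < b) (hc : ∀ k, 0 ≤ c k)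
    (P : Fin K → Matrix (Fin (m + 2)) (Fin (m + 2)) ℝ) (hP0 : P k₀ = a • vecMulVec u u + b • vecMulVec v v)
    (hP : ∀ k, k ≠ k₀ → P k = c k • vecMulVec v v) (hde : d k₀ ≠ e) (hJ : J.det < 0)
    (hmu : J.det * (u ⬝ᵥ J⁻¹ *ᵥ u) ≤ 0) (hmv : J.det * (v ⬝ᵥ J⁻¹ *ᵥ v) ≤ 0)
    (hD2 : 0 < J.det * ((u ⬝ᵥ J⁻¹ *ᵥ u) * (v ⬝ᵥ J⁻¹ *ᵥ v) - (u ⬝ᵥ J⁻¹ *ᵥ v) * (v ⬝ᵥ J⁻¹ *ᵥ u))) :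
    pivotPosRoots e d J P + 1 ≤ 2 * K := by
  classical
  have hK := PosEnds.card_support_vPoly_le d k₀ b c
  unfold pivotPosRoots
  rw [letters_eq_lone_fullRank_anySize d u v k₀ a b c P hP0 hP, ← add_assoc]
  set g : ℝ[X] := Polynomial.C b * X ^ d k₀ + ∑ k ∈ univ.erase k₀, Polynomial.C (c k) * X ^ d k with hgdef
  have hh0 : ∀ j, 0 ≤ (∑ k ∈ univ.erase k₀, Polynomial.C (c k) * (X : ℝ[X]) ^ d k).coeff j := by
    intro j
    rw [finsetSum_coeff]
    refine Finset.sum_nonneg fun k _ => ?_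
    rw [Polynomial.coeff_C_mul_X_pow]
    split_ifs
    · exact hc k
    · exact le_rfl
  have hgp : g.coeff (d k₀) = b + (∑ k ∈ univ.erase k₀, Polynomial.C (c k) * (X : ℝ[X]) ^ d k).coeff (d k₀) := by
    rw [hgdef, coeff_add, Polynomial.coeff_C_mul_X_pow, if_pos rfl]
  have hgp_pos : 0 < g.coeff (d k₀) := by rw [hgp]; linarith [hh0 (d k₀)]
  have hg : g ≠ 0 := fun h0 => by rw [h0, coeff_zero] at hgp_pos; exact lt_irrefl _ hgp_pos
  have hg0 : ∀ j, 0 ≤ g.coeff j := by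
    intro j; rw [hgdef, coeff_add, Polynomial.coeff_C_mul_X_pow]
    split_ifs <;> linarith [hh0 j, hb.le]
  have htd : g.natTrailingDegree ≤ d k₀ := natTrailingDegree_le_of_ne_zero hgp_pos.ne'
  have hdg : d k₀ ≤ g.natDegree := le_natDegree_of_ne_zero hgp_pos.ne'
  have hside : (d k₀ < e ∧ g.natTrailingDegree < e) ∨ (e < d k₀ ∧ e < g.natDegree) := by
    rcases lt_or_gt_of_ne hde with hp | hp
    · exact Or.inl ⟨hp, lt_of_le_of_lt htd hp⟩
    · exact Or.inr ⟨hp, lt_of_lt_of_le hp hdg⟩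
  have h := posRoots_twoDir_anySize_lone_letter e (d k₀) a J hJ u v g ha hg hg0 hmu hmv hD2 hside
  omega

end Summit.ValiantsHypothesis.ValiantsHypothesis.Theorems.LacunarySymmetroidMatrixDescartes.Pivot.TwoDirections.AnySize
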